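import Summits.BirchSwinnertonDyer.Rank1Residual.X11b.KummerRelaxationIndexExact
import Summits.BirchSwinnertonDyer.Rank1Residual.X11b.BDPRouteLevelToKummer
import Summits.BirchSwinnertonDyer.Rank1Residual.X11b.BDPRouteStrictAtPlace
import Summits.BirchSwinnertonDyer.BirchSwinnertonDyer.Theorems.PrintCf2SplitBadTwoLevelEigenSplitting
import Summits.BirchSwinnertonDyer.BirchSwinnertonDyer.Theorems.PrintCf2SplitBadTwoSelmerLocImageDeep
import HarnessLib

/-!
# Crux `PrintCf2.SplitBadTwoRankOneOfFacts` (stmt-BirchSwinnertonDyer-20368), road α v10.3, S3c input (F3) — the CM SPLITTING of the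
# relaxed Kummer group at `v` and the e′-SINGULAR VANISHING: `[H¹_{𝓚, ⊤ at v}(K, E[p^k]) : Sel^{(p^k)}(E/K)]` counts the e-COMPONENT only

Cell `bsd-print-cf2`, EXTRA WIDTH seat `bsd-line-cf2-p1-w8` g3 (prover-bsd-line-cf2-p1-w8-g3-0); `--supports stmt-BirchSwinnertonDyer-20368`
(helper, Theses-free). HONEST FRAMING: nothing here closes the crux or a registered stub; BSD is not proved by any of this; no summit
statement is proved by this seat. No definition, no named fact, no `sorry`, no kit. beyond-print theorem: no.

WHY. p677570 (`SelmerLocImage.relIndex_selmerGroup_kummerOutside_eq_index_of_dense`) computes the EXACT index of the true Selmer group in the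
Kummer group relaxed at the split place `v` («plain» road to hF3 of LEAD cut 14: no dual structure, no eigen local count). That index counts the
singular parts at `v` of the relaxed classes in BOTH CM eigen-components; hF3's `#range(loc_v | 𝔖_{v̄}(K, W*))` is the `W*`(= e)-component. This file
shows, at a finite level `n = p^k` and in X11b currency, that the `W*′`(= e′)-component is EMPTY: a class Kummer away from `v` is AUTOMATICALLY
e′-Kummer at `v`. Mechanism (Cassels–Poitou–Tate, easy direction): reciprocity `Σ_w inv_w(loc_w x ∪ loc_w κ(P)) = 0` (X11b
`Relaxation.invWeilPairing_localization_eq_zero_of_mem_kummerOutside`) + the local Kummer condition is its own annihilator (X11b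
`KummerPT.forall_mem_kummer_invWeilPairing_eq_zero_iff`) + ADJOINTNESS `⟨ẽ′ a, c⟩ = ⟨a, ẽ c⟩` of complementary ISOTROPIC level projectors
(-w4 g9 `LevelEigen.cupProduct_map_levelProj_eq_zero`, `map_restrictField_add_map_restrictField_eq`) + ONE displayed local CM input (hα):
«the e-component of a local Kummer class at `v` is a torsion class coming from `E(K)`» (= the pinning at `v`, e-Kummer is torsion, with
`W*(K_v) = W*(K)`; discharged on frames by the (H1′)/(T-loc-cl) theorems of -w3 g9 / -w8 g2 after transport).

WHAT (generic: `K` number field, `E = W` elliptic, `n` with `NeZero n`, Weil datum `e…`, Poitou–Tate family `inv`, finite place `v`, continuous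
equivariant endomorphisms `eN, eN′` of `E[n]` with `eN + eN′ = 1`, both isotropic for the Weil pairing):
* §1 `invWeilPairing_map_compl_eq` — **`inv_v(H¹(eN′) a ∪ c) = inv_v(a ∪ H¹(eN) c)`**; `invWeilPairing_map_self_eq`.
* §2 **`map_compl_localization_mem_kummer_of_mem_kummerOutside`** — under (hα): for every `x ∈ kummerOutside W n {v}`,
  `H¹(eN′)(loc_v x) ∈ 𝓛_v`; `localization_mem_kummer_iff_of_mem_kummerOutside` — `loc_v x ∈ 𝓛_v ↔ H¹(eN)(loc_v x) ∈ N^E_v`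
  (`N^E_v = ker(H¹(K_v, E[p^k]) → H¹(K_v, E[p^∞]))`); `selmerGroup_eq_kummerOutside_inf_ker` — `Sel^{(p^k)} = KO_v ⊓ ker(ι_* ∘ H¹(ẽ) ∘ loc_v)`.
* §3 **`relIndex_selmerGroup_kummerOutside_eq_natCard_map`** — **`[kummerOutside W (p^k) {v} : Sel^{(p^k)}(E/K)] = #((ι_* ∘ H¹(ẽ) ∘ loc_v)(KO_v))`**,
  the e-component of the singular image, in `H¹(K_v, E[p^∞])`; combined with p677570 this pins `#((ι_* ∘ H¹(ẽ) ∘ loc_v)(KO_v)) = [E(K_v) : E(K) + p^k E(K_v)]`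
  (`natCard_map_eq_index_of_dense`). The identification with `#range(loc_v | 𝔖_{v̄}(K,W*))` (transport `H¹(K_v,·) ↔ H¹(⊤ ⊓ D_v,·)`, -w5 g3 p677230) is the next file.
presearch: Milne ADT I §6 Prop. 6.9 / Lemma 6.15, Thm. 4.10 — tree theorems (X11b); «relaxed Selmer group vs closure of Mordell–Weil» [corpus: MilneADT2006
I.6] — no new fact; galaxy not needed.

References: [MilneADT2006] I Thm. 4.10(b), Cor. 2.3, Lemma 6.15; [PoonenRains2012] Prop. 4.10; [JetchevSkinnerWan2017] Prop. 3.2.1; [Rubin1999] §2.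
-/

noncomputable section

open scoped Classical

set_option linter.dupNamespace false
set_option autoImplicit false

universe u

open Function NumberField IsDedekindDomain WeierstrassCurve Field
open Literature.NumberTheory.EllipticCurves
open Literature.NumberTheory.GaloisRepresentations
open Literature.NumberTheory.GaloisCohomology
open Summit.BirchSwinnertonDyer.Rank1Residual.X11b
open Summit.BirchSwinnertonDyer.Rank1Residual.X11b.Relaxation
open Summit.BirchSwinnertonDyer.Rank1Residual.X11b.LocBridge
open Summit.BirchSwinnertonDyer.BirchSwinnertonDyer.Theorems.PrintCf2.LevelEigen
open scoped ContRepresentation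

namespace Summit.BirchSwinnertonDyer.BirchSwinnertonDyer.Theorems.PrintCf2.SelmerLocImage

-- Cup products need `LocallyCompactSpace Γ`; finiteness of `E[n]` / `μ_n`: local instances as in X11b.
attribute [local instance] absoluteGaloisGroup_compactSpace finite_geomTorsion_of_neZero
  Literature.NumberTheory.EllipticCurves.finite_muCarrier

-- `NeZero (p ^ k)`, as in X11b `KummerPT`.
attribute [local instance] Levels.neZero_pow

variable {K : Type} [Field K] [NumberField K] (W : WeierstrassCurve K) [W.IsElliptic] (p k : ℕ) [hp : Fact p.Prime]
variable (e : W.geomTorsion ((p ^ k : ℕ) : ℤ) → W.geomTorsion ((p ^ k : ℕ) : ℤ) → AlgebraicClosure K)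
  (hμ : ∀ S T, e S T ^ (p ^ k) = 1)
  (hadd₁ : ∀ S₁ S₂ T, e (S₁ + S₂) T = e S₁ T * e S₂ T)
  (hadd₂ : ∀ S T₁ T₂, e S (T₁ + T₂) = e S T₁ * e S T₂)
  (hgal : ∀ (σ : absoluteGaloisGroup K) (S T : W.geomTorsion ((p ^ k : ℕ) : ℤ)), σ • e S T = e (σ • S) (σ • T))
  (halt : ∀ T, e T T = 1) (hnondeg : ∀ T, (∀ S, e S T = 1) → T = 0)
  (inv : LocalInvariants K (p ^ k)) (v : HeightOneSpectrum (𝓞 K))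
  (eN eN' : (W.torsionGaloisModule ((p ^ k : ℕ) : ℤ)).toContRepresentation →ⁱL
    (W.torsionGaloisModule ((p ^ k : ℕ) : ℤ)).toContRepresentation)
  (hsum : ∀ x, eN x + eN' x = x)
  (hiso : ∀ x y, weilPairingHom W (p ^ k) e hμ hadd₁ hadd₂ (eN x) (eN y) = 0)
  (hiso' : ∀ x y, weilPairingHom W (p ^ k) e hμ hadd₁ hadd₂ (eN' x) (eN' y) = 0)

/-! ## §1. Adjointness of complementary isotropic projectors under `inv_v(· ∪ₑ ·)` -/

section Adjoint

omit [W.IsElliptic] in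
include hsum hiso hiso' in
/-- **`inv_v(H¹(eN′) a ∪ c) = inv_v(a ∪ H¹(eN) c)`**: with `a = H¹(eN) a + H¹(eN′) a`, `c = H¹(eN) c + H¹(eN′) c` and the two isotropies
`H¹(eN)· ∪ H¹(eN)· = 0 = H¹(eN′)· ∪ H¹(eN′)·` (-w4 g9 `cupProduct_map_levelProj_eq_zero`), both sides equal `inv_v(H¹(eN′) a ∪ H¹(eN) c)`.
[cite: MilneADT2006, Ch. I §6 proof of Prop. 6.9] [cite: Rubin1999, §2] -/
theorem invWeilPairing_map_compl_eq
    (a c : galoisCohomology ((W.torsionGaloisModule ((p ^ k : ℕ) : ℤ)).toLocal (Sum.inr v : Place K)) 1) :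
    invWeilPairing W (p ^ k) e hμ hadd₁ hadd₂ hgal inv (Sum.inr v)
        (galoisCohomology.map (eN'.restrictField (Place.Completion (Sum.inr v : Place K))) 1 a) c =
      invWeilPairing W (p ^ k) e hμ hadd₁ hadd₂ hgal inv (Sum.inr v) a
        (galoisCohomology.map (eN.restrictField (Place.Completion (Sum.inr v : Place K))) 1 c) := by
  set F := Place.Completion (Sum.inr v : Place K) with hF
  set b := invWeilPairing W (p ^ k) e hμ hadd₁ hadd₂ hgal inv (Sum.inr v) with hb
  have ha := map_restrictField_add_map_restrictField_eq W p k F eN eN' hsum a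
  have hc := map_restrictField_add_map_restrictField_eq W p k F eN eN' hsum c
  -- the two isotropies, read through `inv_v`
  have h0 : ∀ (η : (W.torsionGaloisModule ((p ^ k : ℕ) : ℤ)).toContRepresentation →ⁱL
      (W.torsionGaloisModule ((p ^ k : ℕ) : ℤ)).toContRepresentation)
      (_ : ∀ x y, weilPairingHom W (p ^ k) e hμ hadd₁ hadd₂ (η x) (η y) = 0) (x y : galoisCohomology
        ((W.torsionGaloisModule ((p ^ k : ℕ) : ℤ)).toLocal (Sum.inr v : Place K)) 1),
      b (galoisCohomology.map (η.restrictField F) 1 x) (galoisCohomology.map (η.restrictField F) 1 y) = 0 := by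
    intro η hη x y
    rw [hb, invWeilPairing_apply, weilContPairingLocal_cupProduct_eq_restrict,
      cupProduct_map_levelProj_eq_zero W (p ^ k) e hμ hadd₁ hadd₂ hgal F η hη x y]
    exact (inv (Sum.inr v)).map_zero
  have h1 : b (galoisCohomology.map (eN'.restrictField F) 1 a) c =
      b (galoisCohomology.map (eN'.restrictField F) 1 a) (galoisCohomology.map (eN.restrictField F) 1 c) :=
    calc b (galoisCohomology.map (eN'.restrictField F) 1 a) c
        = b (galoisCohomology.map (eN'.restrictField F) 1 a) (galoisCohomology.map (eN.restrictField F) 1 c +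
            galoisCohomology.map (eN'.restrictField F) 1 c) := by rw [hc]
      _ = b (galoisCohomology.map (eN'.restrictField F) 1 a) (galoisCohomology.map (eN.restrictField F) 1 c) +
            b (galoisCohomology.map (eN'.restrictField F) 1 a) (galoisCohomology.map (eN'.restrictField F) 1 c) :=
          map_add _ _ _
      _ = _ := by rw [h0 eN' hiso', add_zero]
  have h2 : b a (galoisCohomology.map (eN.restrictField F) 1 c) =
      b (galoisCohomology.map (eN'.restrictField F) 1 a) (galoisCohomology.map (eN.restrictField F) 1 c) :=
    calc b a (galoisCohomology.map (eN.restrictField F) 1 c)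
        = b (galoisCohomology.map (eN.restrictField F) 1 a + galoisCohomology.map (eN'.restrictField F) 1 a)
            (galoisCohomology.map (eN.restrictField F) 1 c) := by rw [ha]
      _ = b (galoisCohomology.map (eN.restrictField F) 1 a) (galoisCohomology.map (eN.restrictField F) 1 c) +
            b (galoisCohomology.map (eN'.restrictField F) 1 a) (galoisCohomology.map (eN.restrictField F) 1 c) := by
          exact DFunLike.congr_fun (b.map_add _ _) _
      _ = _ := by rw [h0 eN hiso, zero_add]
  rw [h1, h2]

end Adjoint

/-! ## §2. The e′-singular vanishing at the relaxed place -/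

section Vanishing

include hgal halt hnondeg hsum hiso hiso' in
/-- **THE e′-SINGULAR VANISHING.** Let `x ∈ kummerOutside W (p^k) {v}` (Kummer at every place `≠ v`, free at `v`). Assume the Poitou–Tate sum
vanishes (`SumLocalTermEqZero`), `inv_v` is injective, Tate's count `#H¹(K_v, E[p^k]) = #𝓛_v²`, and the local CM input
**(hα) «for every local Kummer class `c ∈ 𝓛_v`, its e-component `H¹(eN) c` is the localisation of a global Kummer class `κ(P)`, `P ∈ E(K)`»**
(pinning at `v`: e-Kummer is torsion, all of it rational over `K`). Then **the e′-component `H¹(eN′)(loc_v x)` lies in `𝓛_v`**: for `c ∈ 𝓛_v`,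
`inv_v(H¹(eN′) loc_v x ∪ c) = inv_v(loc_v x ∪ H¹(eN) c) = inv_v(loc_v x ∪ loc_v κ(P)) = 0` by reciprocity (X11b
`invWeilPairing_localization_eq_zero_of_mem_kummerOutside`), and `𝓛_v` is its own annihilator (X11b `forall_mem_kummer_invWeilPairing_eq_zero_iff`).
[cite: MilneADT2006, Ch. I, Thm. 4.10(b) and Lemma 6.15] [cite: JetchevSkinnerWan2017, Prop. 3.2.1 (proof)] -/
theorem map_compl_localization_mem_kummer_of_mem_kummerOutside (hinv : Injective (inv (Sum.inr v)))
    (hPT : inv.SumLocalTermEqZero)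
    (hEuler : Nat.card (galoisCohomology ((W.torsionGaloisModule ((p ^ k : ℕ) : ℤ)).toLocal (Sum.inr v)) 1) =
      (Nat.card (nsmulAddMonoidHom (p ^ k) : (W.baseChange (v.adicCompletion K)).toAffine.Point →+ _).ker *
        Nat.card (v.adicCompletionIntegers K ⧸ Ideal.span {((p ^ k : ℕ) : v.adicCompletionIntegers K)})) ^ 2)
    (hα : ∀ c ∈ W.kummerSelmerStructure ((p ^ k : ℕ) : ℤ) (Sum.inr v), ∃ P : W.toAffine.Point, IsOfFinAddOrder P ∧
      galoisCohomology.map (eN.restrictField (Place.Completion (Sum.inr v : Place K))) 1 c =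
        galoisCohomology.localization (W.torsionGaloisModule ((p ^ k : ℕ) : ℤ)) (Sum.inr v) 1
          (kummerMapTorsion W ((p ^ k : ℕ) : ℤ) (W.zsmul_geomPoints_surjective_holds (NeZero.ne _)) P))
    {x : galoisCohomology (W.torsionGaloisModule ((p ^ k : ℕ) : ℤ)) 1} (hx : x ∈ kummerOutside W (p ^ k) {Sum.inr v}) :
    galoisCohomology.map (eN'.restrictField (Place.Completion (Sum.inr v : Place K))) 1
        (galoisCohomology.localization (W.torsionGaloisModule ((p ^ k : ℕ) : ℤ)) (Sum.inr v) 1 x) ∈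
      W.kummerSelmerStructure ((p ^ k : ℕ) : ℤ) (Sum.inr v) := by
  refine (KummerPT.forall_mem_kummer_invWeilPairing_eq_zero_iff W p k e hμ hadd₁ hadd₂ hgal halt hnondeg v hinv hEuler _).mp
    fun c hc ↦ ?_
  obtain ⟨P, -, hP⟩ := hα c hc
  rw [invWeilPairing_map_compl_eq W p k e hμ hadd₁ hadd₂ hgal inv v eN eN' hsum hiso hiso', hP]
  exact invWeilPairing_localization_eq_zero_of_mem_kummerOutside W (p ^ k) e hμ hadd₁ hadd₂ hgal halt inv hPT
    (Sum.inr v) hx P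


include hgal halt hnondeg hsum hiso hiso' in
/-- **Kummer at `v` ⟺ e-torsion-Kummer at `v`**, for classes Kummer away from `v`: under the hypotheses of
`map_compl_localization_mem_kummer_of_mem_kummerOutside`, for `x ∈ kummerOutside W (p^k) {v}`:
`loc_v x ∈ 𝓛_v ↔ H¹(eN)(loc_v x) ∈ N^E_v := ker(H¹(K_v, E[p^k]) → H¹(K_v, E[p^∞]))`. (`→`: by (hα) the e-component of a Kummer class is
the class of a rational TORSION point, which dies in `H¹(K_v, E[p^∞])` — X11b `map_torsion_localKummerMap_eq_ker_map_primaryInclusion`; `←`: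
`loc_v x = H¹(eN) loc_v x + H¹(eN′) loc_v x` with `N^E_v ⊆ 𝓛_v` (X11b `ker_map_primaryInclusion_le_kummerLocalConditionAt`) and §2.)
[cite: MilneADT2006, Ch. I, Lemma 6.15] [cite: JetchevSkinnerWan2017, §3.3.1] -/
theorem localization_mem_kummer_iff_of_mem_kummerOutside (hinv : Injective (inv (Sum.inr v)))
    (hPT : inv.SumLocalTermEqZero)
    (hEuler : Nat.card (galoisCohomology ((W.torsionGaloisModule ((p ^ k : ℕ) : ℤ)).toLocal (Sum.inr v)) 1) =
      (Nat.card (nsmulAddMonoidHom (p ^ k) : (W.baseChange (v.adicCompletion K)).toAffine.Point →+ _).ker *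
        Nat.card (v.adicCompletionIntegers K ⧸ Ideal.span {((p ^ k : ℕ) : v.adicCompletionIntegers K)})) ^ 2)
    (hα : ∀ c ∈ W.kummerSelmerStructure ((p ^ k : ℕ) : ℤ) (Sum.inr v), ∃ P : W.toAffine.Point, IsOfFinAddOrder P ∧
      galoisCohomology.map (eN.restrictField (Place.Completion (Sum.inr v : Place K))) 1 c =
        galoisCohomology.localization (W.torsionGaloisModule ((p ^ k : ℕ) : ℤ)) (Sum.inr v) 1
          (kummerMapTorsion W ((p ^ k : ℕ) : ℤ) (W.zsmul_geomPoints_surjective_holds (NeZero.ne _)) P))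
    {x : galoisCohomology (W.torsionGaloisModule ((p ^ k : ℕ) : ℤ)) 1} (hx : x ∈ kummerOutside W (p ^ k) {Sum.inr v}) :
    galoisCohomology.localization (W.torsionGaloisModule ((p ^ k : ℕ) : ℤ)) (Sum.inr v) 1 x ∈
        W.kummerSelmerStructure ((p ^ k : ℕ) : ℤ) (Sum.inr v) ↔
      galoisCohomology.map (eN.restrictField (Place.Completion (Sum.inr v : Place K))) 1
          (galoisCohomology.localization (W.torsionGaloisModule ((p ^ k : ℕ) : ℤ)) (Sum.inr v) 1 x) ∈
        (galoisCohomology.map ((Levels.primaryInclusion W p k).restrictField (Place.Completion (Sum.inr v : Place K))) 1).ker := by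
  set F := Place.Completion (Sum.inr v : Place K) with hF
  haveI : CharZero F := charZero_placeCompletion (K := K) (Sum.inr v)
  have hne : ((p ^ k : ℕ) : ℤ) ≠ 0 := NeZero.ne _
  constructor
  · intro h
    obtain ⟨P, hPtors, hP⟩ := hα _ h
    rw [hP]
    -- the Kummer class of a rational torsion point dies in `H¹(K_v, E[p^∞])`
    have hmem : galoisCohomology.localization (W.torsionGaloisModule ((p ^ k : ℕ) : ℤ)) (Sum.inr v) 1
        (kummerMapTorsion W ((p ^ k : ℕ) : ℤ) (W.zsmul_geomPoints_surjective_holds hne) P) ∈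
        (AddCommGroup.torsion (W.baseChange F).toAffine.Point).map (W.localKummerMap F hne) := by
      change galoisCohomology.res (W.torsionGaloisModule ((p ^ k : ℕ) : ℤ)) F 1 _ ∈ _
      rw [KummerIndex.res_kummerMapTorsion_eq_localKummerMap W F hne]
      exact ⟨_, (AddCommGroup.mem_torsion _).mpr ((Affine.Point.baseChange (W' := W) K F).isOfFinAddOrder hPtors), rfl⟩
    rw [LevelKummer.map_torsion_localKummerMap_eq_ker_map_primaryInclusion W p k F hne] at hmem
    exact hmem
  · intro h
    have hsplit := map_restrictField_add_map_restrictField_eq W p k F eN eN' hsum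
      (galoisCohomology.localization (W.torsionGaloisModule ((p ^ k : ℕ) : ℤ)) (Sum.inr v) 1 x)
    rw [← hsplit]
    refine AddSubgroup.add_mem _ ?_
      (map_compl_localization_mem_kummer_of_mem_kummerOutside W p k e hμ hadd₁ hadd₂ hgal halt hnondeg inv v eN eN'
        hsum hiso hiso' hinv hPT hEuler hα hx)
    have hle := LevelKummer.ker_map_primaryInclusion_le_kummerLocalConditionAt W p k F
    exact hle h

end Vanishing

/-! ## §3. `[KO_v : Sel]` counts the e-component of the singular image at `v` -/

section Count

include hgal halt hnondeg hsum hiso hiso' in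
/-- **`Sel^{(p^k)}(E/K) = KO_v ⊓ ker(ι_* ∘ H¹(eN) ∘ loc_v)`**: a class Kummer away from `v` is Selmer iff the e-component of its localisation at `v`
dies in `H¹(K_v, E[p^∞])` (§2 + X11b `selmerGroup_eq_comap_inf_kummerOutside`). [cite: MilneADT2006, Ch. I, Lemma 6.15] -/
theorem selmerGroup_eq_kummerOutside_inf_ker (hinv : Injective (inv (Sum.inr v)))
    (hPT : inv.SumLocalTermEqZero)
    (hEuler : Nat.card (galoisCohomology ((W.torsionGaloisModule ((p ^ k : ℕ) : ℤ)).toLocal (Sum.inr v)) 1) =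
      (Nat.card (nsmulAddMonoidHom (p ^ k) : (W.baseChange (v.adicCompletion K)).toAffine.Point →+ _).ker *
        Nat.card (v.adicCompletionIntegers K ⧸ Ideal.span {((p ^ k : ℕ) : v.adicCompletionIntegers K)})) ^ 2)
    (hα : ∀ c ∈ W.kummerSelmerStructure ((p ^ k : ℕ) : ℤ) (Sum.inr v), ∃ P : W.toAffine.Point, IsOfFinAddOrder P ∧
      galoisCohomology.map (eN.restrictField (Place.Completion (Sum.inr v : Place K))) 1 c =
        galoisCohomology.localization (W.torsionGaloisModule ((p ^ k : ℕ) : ℤ)) (Sum.inr v) 1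
          (kummerMapTorsion W ((p ^ k : ℕ) : ℤ) (W.zsmul_geomPoints_surjective_holds (NeZero.ne _)) P)) :
    W.selmerGroup ((p ^ k : ℕ) : ℤ) = kummerOutside W (p ^ k) {Sum.inr v} ⊓
      ((galoisCohomology.map ((Levels.primaryInclusion W p k).restrictField (Place.Completion (Sum.inr v : Place K))) 1).comp
        ((galoisCohomology.map (eN.restrictField (Place.Completion (Sum.inr v : Place K))) 1).comp
          (galoisCohomology.localization (W.torsionGaloisModule ((p ^ k : ℕ) : ℤ)) (Sum.inr v) 1))).ker := by
  rw [KummerPT.selmerGroup_eq_comap_inf_kummerOutside W p k v]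
  apply le_antisymm
  · intro x hx
    have h1 := (AddSubgroup.mem_inf.mp hx).1
    have h2 := (AddSubgroup.mem_inf.mp hx).2
    refine AddSubgroup.mem_inf.mpr ⟨h2, AddMonoidHom.mem_ker.mpr ?_⟩
    exact AddMonoidHom.mem_ker.mp ((localization_mem_kummer_iff_of_mem_kummerOutside W p k e hμ hadd₁ hadd₂ hgal halt
      hnondeg inv v eN eN' hsum hiso hiso' hinv hPT hEuler hα h2).mp (AddSubgroup.mem_comap.mp h1))
  · intro x hx
    have h2 := (AddSubgroup.mem_inf.mp hx).1
    have h1 := AddMonoidHom.mem_ker.mp (AddSubgroup.mem_inf.mp hx).2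
    exact AddSubgroup.mem_inf.mpr ⟨AddSubgroup.mem_comap.mpr
      ((localization_mem_kummer_iff_of_mem_kummerOutside W p k e hμ hadd₁ hadd₂ hgal halt hnondeg inv v eN eN'
        hsum hiso hiso' hinv hPT hEuler hα h2).mpr (AddMonoidHom.mem_ker.mpr h1)), h2⟩

include hgal halt hnondeg hsum hiso hiso' in
/-- **`[kummerOutside W (p^k) {v} : Sel^{(p^k)}(E/K)] = #((ι_* ∘ H¹(eN) ∘ loc_v)(kummerOutside W (p^k) {v}))`** — the relaxation index at `v` counts
ONLY the e-component of the singular parts at `v` (the e′-component is empty, §2). With p677570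
(`relIndex_selmerGroup_kummerOutside_eq_index_of_dense`) the left side is `[E(K_v) : E(K) + p^k E(K_v)]` at every deep level.
[cite: MilneADT2006, Ch. I, Thm. 4.10(b) and Lemma 6.15] [cite: JetchevSkinnerWan2017, Prop. 3.2.1] -/
theorem relIndex_selmerGroup_kummerOutside_eq_natCard_map (hinv : Injective (inv (Sum.inr v)))
    (hPT : inv.SumLocalTermEqZero)
    (hEuler : Nat.card (galoisCohomology ((W.torsionGaloisModule ((p ^ k : ℕ) : ℤ)).toLocal (Sum.inr v)) 1) =
      (Nat.card (nsmulAddMonoidHom (p ^ k) : (W.baseChange (v.adicCompletion K)).toAffine.Point →+ _).ker *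
        Nat.card (v.adicCompletionIntegers K ⧸ Ideal.span {((p ^ k : ℕ) : v.adicCompletionIntegers K)})) ^ 2)
    (hα : ∀ c ∈ W.kummerSelmerStructure ((p ^ k : ℕ) : ℤ) (Sum.inr v), ∃ P : W.toAffine.Point, IsOfFinAddOrder P ∧
      galoisCohomology.map (eN.restrictField (Place.Completion (Sum.inr v : Place K))) 1 c =
        galoisCohomology.localization (W.torsionGaloisModule ((p ^ k : ℕ) : ℤ)) (Sum.inr v) 1
          (kummerMapTorsion W ((p ^ k : ℕ) : ℤ) (W.zsmul_geomPoints_surjective_holds (NeZero.ne _)) P)) :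
    (W.selmerGroup ((p ^ k : ℕ) : ℤ)).relIndex (kummerOutside W (p ^ k) {Sum.inr v}) =
      Nat.card ((kummerOutside W (p ^ k) {Sum.inr v}).map
        (((galoisCohomology.map ((Levels.primaryInclusion W p k).restrictField (Place.Completion (Sum.inr v : Place K))) 1).comp
          ((galoisCohomology.map (eN.restrictField (Place.Completion (Sum.inr v : Place K))) 1).comp
            (galoisCohomology.localization (W.torsionGaloisModule ((p ^ k : ℕ) : ℤ)) (Sum.inr v) 1))))) := by
  set Ψ := ((galoisCohomology.map ((Levels.primaryInclusion W p k).restrictField (Place.Completion (Sum.inr v : Place K))) 1).comp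
    ((galoisCohomology.map (eN.restrictField (Place.Completion (Sum.inr v : Place K))) 1).comp
      (galoisCohomology.localization (W.torsionGaloisModule ((p ^ k : ℕ) : ℤ)) (Sum.inr v) 1))) with hΨ
  have h1 : (Ψ.ker ⊓ kummerOutside W (p ^ k) {Sum.inr v}).relIndex (kummerOutside W (p ^ k) {Sum.inr v}) =
      Nat.card ((kummerOutside W (p ^ k) {Sum.inr v}).map Ψ) := by
    rw [AddSubgroup.inf_relIndex_right, AddSubgroup.relIndex_ker]
  rw [selmerGroup_eq_kummerOutside_inf_ker W p k e hμ hadd₁ hadd₂ hgal halt hnondeg inv v eN eN' hsum hiso hiso' hinv hPT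
    hEuler hα, inf_comm]
  exact h1

end Count

/-! ## §4. With p677570: the e-component of the singular image has exactly `[E(K_v) : E(K) + p^k E(K_v)]` elements -/

section WithIndex

include hgal halt hnondeg hsum hiso hiso' in
/-- **`#((ι_* ∘ H¹(eN) ∘ loc_v)(kummerOutside W (p^k) {v})) = [E(K_v) : im E(K) + p^k E(K_v)]`** at every level `p^k` with `p^j` (`j ≤ k`) killing
`Ш(E/K) ∩ H¹(K,E)[p^k]` and `p^{k−j} E(K_v) ⊆ E(K) + p^k E(K_v)` (§3 ∘ p677570 `relIndex_selmerGroup_kummerOutside_eq_index_of_dense`), for `K` with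
complex infinite places, CONDITIONAL on the named fact `poitouTate_selmerStructure_duality K`; the Poitou–Tate family is taken from the fact, the
Weil datum `e` and the isotropic splitting `eN + eN′ = 1` are inputs (on an S3c frame: `W.exists_weilPairing_holds` and -w4 g9
`LevelEigen.exists_isotropic_levelSplitting_of_frame`). [cite: MilneADT2006, Ch. I, Thm. 4.10(b), Lemma 6.15, §6 Prop. 6.9]
[cite: Howard2004HeegnerKolyvagin, Thm. 2.1.11 (arXiv:1202.6340 p. 6)] -/
theorem natCard_map_kummerOutside_eq_index_of_dense (hK : ∀ w : InfinitePlace K, w.IsComplex) (hk : 0 < k)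
    (hPT : poitouTate_selmerStructure_duality K)
    (hα : ∀ c ∈ W.kummerSelmerStructure ((p ^ k : ℕ) : ℤ) (Sum.inr v), ∃ P : W.toAffine.Point, IsOfFinAddOrder P ∧
      galoisCohomology.map (eN.restrictField (Place.Completion (Sum.inr v : Place K))) 1 c =
        galoisCohomology.localization (W.torsionGaloisModule ((p ^ k : ℕ) : ℤ)) (Sum.inr v) 1
          (kummerMapTorsion W ((p ^ k : ℕ) : ℤ) (W.zsmul_geomPoints_surjective_holds (NeZero.ne _)) P))
    {j : ℕ} (hjk : j ≤ k)
    (hSha : W.sha ⊓ AddSubgroup.torsionBy W.galH1 ((p ^ k : ℕ) : ℤ) ≤ AddSubgroup.torsionBy W.galH1 ((p ^ j : ℕ) : ℤ))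
    (hdense : (zsmulAddGroupHom ((p ^ (k - j) : ℕ) : ℤ) : (W.baseChange (v.adicCompletion K)).toAffine.Point →+ _).range ≤
      (Affine.Point.baseChange (W' := W) K (v.adicCompletion K)).range ⊔
        (zsmulAddGroupHom ((p ^ k : ℕ) : ℤ) : (W.baseChange (v.adicCompletion K)).toAffine.Point →+ _).range) :
    Nat.card ((kummerOutside W (p ^ k) {Sum.inr v}).map
        (((galoisCohomology.map ((Levels.primaryInclusion W p k).restrictField (Place.Completion (Sum.inr v : Place K))) 1).comp
          ((galoisCohomology.map (eN.restrictField (Place.Completion (Sum.inr v : Place K))) 1).comp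
            (galoisCohomology.localization (W.torsionGaloisModule ((p ^ k : ℕ) : ℤ)) (Sum.inr v) 1))))) =
      ((Affine.Point.baseChange (W' := W) K (v.adicCompletion K)).range ⊔
        (zsmulAddGroupHom ((p ^ k : ℕ) : ℤ) : (W.baseChange (v.adicCompletion K)).toAffine.Point →+ _).range).index := by
  obtain ⟨inv, hperf, hsumPT, -, -⟩ := hPT (p ^ k)
  have hpp : IsPrimePow (p ^ k) := ⟨p, k, hp.out.prime, hk, rfl⟩
  have hEuler := natCard_galoisCohomology_one_torsion_adicCompletion_eq_sq W v (p ^ k) hpp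
    (RestrictedSelmerPair.localEulerPoincareCharacteristic_adicCompletion_of_numberField v)
  rw [← relIndex_selmerGroup_kummerOutside_eq_natCard_map W p k e hμ hadd₁ hadd₂ hgal halt hnondeg inv v eN eN' hsum hiso hiso'
    (hperf v).1.1 hsumPT hEuler hα]
  exact relIndex_selmerGroup_kummerOutside_eq_index_of_dense W p k hK hk hPT v hjk hSha hdense

end WithIndex


end Summit.BirchSwinnertonDyer.BirchSwinnertonDyer.Theorems.PrintCf2.SelmerLocImage

end
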